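import Summits.QuantumFields.YangMills.Theorems.BalabanUVNodesN11NoExpansionGeneralStepCoPH
import Literature.MathematicalPhysics.QuantumFieldTheory.Balaban1983to89.Node00.Record12LocalLawsTwoScale

/-!
# DAG node N11 — THE GENERAL-HISTORY 𝐓-STEP AT THE v1.7 RECORD WITH THE OLD-BRANCH MEASURABILITY ∕ BOUND ONLY: under the generation-`k` pin with the old front
# factor, the NEW integrand per old branch `S` IS `χ_k(Ω_k(init s′))(U)·w_k(s′)(U, Ū)·𝐓_k(init s′, S)[e^{A_k(init s′)}](U)` — a function of the scale-`k`
# variables alone — so p544575's displayed measurability ∕ bound of the NEW integrand reduce to the displayed measurability ∕ bound of the OLD branch (the same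
# hypothesis class as the diagonal theorems p535033 §3 ∕ p541699 §5), the rows `zetaAbs`, `tstep.measW`, `measChi` supplying the rest

Cell `pub-ymgap`, YM-PLAN Track A (HUMAN RULING D-0062), seat `pub-ymgap-dag-n11-d` (g8; R134 fan-out seat N11 [B14], strategy s2), route `BalabanUVNodes`
rev 25, item K1⁷ `StabilityBAtRecordR13SepCoPH` = stmt-QuantumFields-20542 (helper, count-neutral).  [III] = [Balaban1988Convergent].
Sequel of `…NoExpansionGeneralStepCoPH` (p544575) over `…NoExpansionOldFactors` (p543804: `oldFactors_agree_of_Omega_empty`), `…NoExpansionZetaSpecSucc` (p527502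
§1 `noExpIntegrandAt_eq_zetaFactor_mul`) and node00-def-T's FILE 27 (`Provisos₁₃CoPH`).

WHY THIS FILE.  p544575 displays `hm`∕`hC` on the NEW integrand `ζ_k(T)·w_k(∅,∅,∅)·𝐓_k(init s′, S)[e^{A_{k+1}(s′)}]` at the two-scale configuration — an object
that mentions the new operand.  But under the file's own hypotheses that integrand has a CLOSED FORM in the scale-`k` variables: the old factors agree
(`oldFactors_agree_of_Omega_empty`, constant `1` at `E_{k+1} = E_k`) and the pin (V) with `quad_k(∅) = 0` gives `ζ_k(T)·w_k(∅,∅,∅)(U, V′) = χ_k(init s′)(U)·w_k(s′)(U, Ū)`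
for EVERY `V′`.  So joint measurability ∕ boundedness of the new integrand follow from measurability ∕ boundedness of the OLD branch
`U ↦ 𝐓_k(init s′, S)[e^{A_k(init s′)}](U)` (displayed: `hmB`, `hCB` — the restricted-averaging kernel has no measurability ∕ bound lemma in the tree), of
`χ_k(init s′)` (row `measChi` one level down; `|χ| ≤ 1`), and of `w_k(s′)` on the graph (`tstep.measW`; `|w| ≤ 1` from row `zetaAbs`).

WHAT THIS FILE PROVES (0 `sorry`, 0 `def`, standard axioms; `N`-generic).  `newIntegrand_eq_of_pinChi` (the closed form, every `V′`) · `measurable_chiSeqOfRecord_init`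
(level `k` front factor of `init s′` from `Provisos₁₃CoPH`) · ★★ `clause_succ_CoPH_of_Omega_empty_of_pinChi_of_oldBranch_of_clause` (p544575's provisos-keyed step with
`hmB`∕`hCB` on the OLD branch in place of `hm`∕`hC`) · `exists_clause_succ_CoPH_of_Omega_empty_of_sLaw₁₃CoPH_of_oldBranch` (keyed on `SLaw₁₃CoPH θ p k`) ·
`clause_succ_CoPH_of_Omega_empty_of_levelFree_of_pinChi_of_oldBranch_of_clause` ((P) dropped for a LENGTH-FREE `Zh`).

HONEST FRAMING ∕ A6.  Count-neutral kernel bookkeeping; displayed binders as in p544575 with `hm`∕`hC` replaced by `hmB`∕`hCB` (properties of the old branch, not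
exhibited — g7's located dead end; inhabited nowhere in the tree yet); (P)∕(V)∕`hqloc`∕`hA` inhabited at the door of K0a's cured witness (this seat՚s `…NoExpansionGeneralStepCoPHDoor`, INTENT-8);
nothing of Bałaban's asserted; N11 NOT discharged; K1⁷ NOT closed; counts unmoved (typed 28∕28 · discharged 5∕28).  One finite four-torus programme at fixed
`ε = L^{−K}`; NOT ℝ⁴, NOT OS, NOT a mass gap, NOT Clay.  Sources: [III] Theorem p.245, (2.18) p.257, (2.20)–(2.25) pp.258–259, (3.1) p.264, (3.16) p.268,
(3.24)–(3.25) p.270; [Balaban1985Averaging] (10) p.19.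
-/

noncomputable section

open MeasureTheory
open scoped BigOperators Matrix.Norms.L2Operator

namespace Summit.QuantumFields.YangMills.Theorems.BalabanUVNodesN11NoExpansionGeneralStepCoPHOldBranch

open Literature.MathematicalPhysics.QuantumFieldTheory.Balaban1983to89 T4Continuum Node00 Node00.Tk DagBinding
open B15DeterminingSets
open BalabanUVNodesN11NoExpansionZetaSpecSucc (noExpIntegrandAt_eq_zetaFactor_mul)
open BalabanUVNodesN11NoExpansionDiagonalAtZ (tkWeightsOfRecordP_ζ_apply tkWeightsOfRecordP_w_empty tkWeightsOfRecordP_ζ_local)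
open BalabanUVNodesN11NoExpansionOldFactors (oldFactors_agree_of_Omega_empty)
open BalabanUVNodesN11NoExpansionDiagonalCoPH (WtOfRecord₁₃H_eq_tkWeightsOfRecordP)
open BalabanUVNodesN11NoExpansionGeneralStepCoPH (clause_succ_CoPH_of_Omega_empty_of_pinChi_of_provisos_of_clause tkWeightsOfRecordP_w_local_of_quad_local
  prefix_agree_of_levelFree_of_Omega_empty)

variable {F : T4Family} {N : ℕ} [NeZero N]

section OldBranch

variable (θ : Stage13HParams F N) (p : B12.RunParams)

/-- **THE LEVEL-`k` FRONT FACTOR OF `init s′` IS MEASURABLE** from the v1.7 core provisos (row `measChi` one level down; constant `1` at `k = 0`).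
[cite: Balaban1988Convergent, (2.17)–(2.18) p.257 (bookkeeping)] -/
theorem measurable_chiSeqOfRecord_init (h : θ.Provisos₁₃CoPH F N) {k : ℕ} (hk : k < p.K)
    (s : SeqOfRecord F θ.ν θ.τ9.M (gOfRecord₁₃ F N θ.toStage13Params p) p.K (k + 1)) :
    Measurable (chiSeqOfRecord F N θ.ν θ.τ9.M (gOfRecord₁₃ F N θ.toStage13Params p) p.K k s.init) := by
  rcases Nat.eq_zero_or_pos k with hk0 | hkpos
  · subst hk0
    have : chiSeqOfRecord F N θ.ν θ.τ9.M (gOfRecord₁₃ F N θ.toStage13Params p) p.K 0 s.init = fun _ => 1 :=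
      funext fun U => chiSeqOfRecord_zero F N θ.ν θ.τ9.M _ p.K s.init U
    rw [this]
    exact measurable_const
  · obtain ⟨k', rfl⟩ : ∃ k', k = k' + 1 := ⟨k - 1, by omega⟩
    exact h.measChi p k' (by omega) s.init

/-- **THE NEW INTEGRAND IN CLOSED FORM UNDER THE PIN**: for a no-expansion `s′` and an old branch `S`, at every two-scale configuration `(U, V′)`,
`ζ_k(T)·w_k(∅,∅,∅)·𝐓_k(init s′,S)[e^{A_{k+1}(s′)}] (U, V′) = χ_k(init s′)(U)·w_k(s′)(U, Ū)·𝐓_k(init s′,S)[e^{A_k(init s′)}] (U)` — old factors agree (p543804), pin (V) and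
`quad_k(∅) = 0` on the two-scale configurations. [cite: Balaban1988Convergent, (3.24)–(3.25) p.270, (2.20)–(2.23) p.258] -/
theorem newIntegrand_eq_of_pinChi (hM : 1 ≤ θ.τ9.M) {k : ℕ}
    (s : SeqOfRecord F θ.ν θ.τ9.M (gOfRecord₁₃ F N θ.toStage13Params p) p.K (k + 1)) (hΩ : s.Ω (k + 1) = ∅)
    (hloc : (θ.zhAt p s).LocalLaws)
    (hqloc : ∀ j, j < k → ∀ ω ω' : MultiCfg (F.P p.K) (SU N) (FluctV N), (∀ i, i ≤ k → ω i = ω' i) →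
      (θ.zhAt p s).quad j (s.init.Λ (j + 1)) ω = (θ.zhAt p s).quad j (s.init.Λ (j + 1)) ω')
    (t : Sect2.TermValues (F.P p.K) (MatA N) (FluctV N) θ.τ9.M) (E₀ : ℝ) (S : ℕ → Set (Site (F.P p.K) 0))
    (hA : ∀ (a a' : Tk.MSFluct (F.P p.K) (FluctV N)) (Uf : GaugeField (F.P p.K) 0 (SU N)), (∀ i, i ≤ k → a i = a' i) →
      (sect2ActionDataOfRecord F N (FluctV N) p.K (settingOfRecord₁₃ F N θ.toStage13Params p) (θ.rzAt p s.init) s.init t (S, a) E₀).action23 k Uf =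
        (sect2ActionDataOfRecord F N (FluctV N) p.K (settingOfRecord₁₃ F N θ.toStage13Params p) (θ.rzAt p s.init) s.init t (S, a') E₀).action23 k Uf)
    (hZ : ∀ (V' : GaugeField (F.P p.K) (k + 1) (SU N)) (U₀ : GaugeField (F.P p.K) k (SU N)),
      (θ.zhAt p s).ζ0 k Set.univ (pairCfgAt (V := FluctV N) k V' U₀) =
        chiSeqOfRecord F N θ.ν θ.τ9.M (gOfRecord₁₃ F N θ.toStage13Params p) p.K k s.init U₀ *
          wOfRecord₉ F N θ.toStage9Params p (gOfRecord₁₃ F N θ.toStage13Params p) k s U₀ ((avOfRecord F N p.K k).avg U₀))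
    (hq : ∀ (V' : GaugeField (F.P p.K) (k + 1) (SU N)) (U₀ : GaugeField (F.P p.K) k (SU N)), (θ.zhAt p s).quad k ∅ (pairCfgAt (V := FluctV N) k V' U₀) = 0)
    (V' : GaugeField (F.P p.K) (k + 1) (SU N)) (U₀ : GaugeField (F.P p.K) k (SU N)) :
    noExpIntegrandAt F N (FluctV N) p.K k (WtOfRecord₁₃H F N θ p s)
        (tkBranchOfRecord F N (FluctV N) θ.ν θ.τ9.M _ p.K (WtOfRecord₁₃H F N θ p s) s.init S k
          (fun ω => sect2Operand F N (FluctV N) p.K (settingOfRecord₁₃ F N θ.toStage13Params p) (θ.rzAt p s) s t E₀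
            (UbgOfRecord₁₃CoP F N θ.toStage13Params p (k + 1) s) (S, fun j => (ω j).2) (fun j => (ω j).1)))
        V' U₀ =
      chiSeqOfRecord F N θ.ν θ.τ9.M (gOfRecord₁₃ F N θ.toStage13Params p) p.K k s.init U₀ *
        wOfRecord₉ F N θ.toStage9Params p (gOfRecord₁₃ F N θ.toStage13Params p) k s U₀ ((avOfRecord F N p.K k).avg U₀) *
        tkBranchOfRecord F N (FluctV N) θ.ν θ.τ9.M _ p.K (WtOfRecord₁₃H F N θ p s) s.init S k
          (fun ω => sect2Operand F N (FluctV N) p.K (settingOfRecord₁₃ F N θ.toStage13Params p) (θ.rzAt p s.init) s.init t E₀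
            (UbgOfRecord₁₃CoP F N θ.toStage13Params p k s.init) (S, fun j => (ω j).2) (fun j => (ω j).1))
          (baseCfg (V := FluctV N) k U₀) := by
  have hζloc : ∀ j, j < k → ∀ ω ω' : MultiCfg (F.P p.K) (SU N) (FluctV N), (∀ i, i ≤ k → ω i = ω' i) →
      (WtOfRecord₁₃H F N θ p s).ζ j (s.init.Ω (j + 1))ᶜ ω = (WtOfRecord₁₃H F N θ p s).ζ j (s.init.Ω (j + 1))ᶜ ω' :=
    fun _ hj ω ω' hh => hloc.localLaws₂.zeta0_local_lt hj _ ω ω' hh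
  have hwloc : ∀ j, j < k → ∀ ω ω' : MultiCfg (F.P p.K) (SU N) (FluctV N), (∀ i, i ≤ k → ω i = ω' i) →
      (WtOfRecord₁₃H F N θ p s).w j (s.init.Λ (j + 1)) ((s.init.Λ (j + 1))ᶜ ∩ s.init.Ω (j + 1)) (S (j + 1)) ω =
        (WtOfRecord₁₃H F N θ p s).w j (s.init.Λ (j + 1)) ((s.init.Λ (j + 1))ᶜ ∩ s.init.Ω (j + 1)) (S (j + 1)) ω' :=
    fun j hj ω ω' hh => tkWeightsOfRecordP_w_local_of_quad_local (θ.zhAt p s) hj _ _ _ (hqloc j hj) ω ω' hh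
  rw [noExpIntegrandAt_eq_zetaFactor_mul,
    oldFactors_agree_of_Omega_empty θ.toStage13Params p hM s hΩ (WtOfRecord₁₃H F N θ p s) hζloc S hwloc (θ.rzAt p s.init) (θ.rzAt p s)
      t E₀ E₀ hA V' U₀, sub_self, Real.exp_zero, one_mul,
    WtOfRecord₁₃H_eq_tkWeightsOfRecordP, tkWeightsOfRecordP_ζ_apply, tkWeightsOfRecordP_w_empty, hq, mul_zero, Real.exp_zero, mul_one, hZ]

/-- **★★ THE GENERAL-HISTORY 𝐓-STEP AT THE v1.7 RECORD, OLD-BRANCH FORM** (p544575's provisos-keyed theorem with the measurability ∕ bound asked of the OLD branch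
`U ↦ 𝐓_k(init s′, S)[e^{A_k(init s′)}](U)` only): `hid` at `init s′` ⇒ the 𝐓-image clause at `s′`, same `t`, same `E₀`, under (P) `hpre`, (V) `hZ`+`hq`, `hqloc`, `hA`,
`hmB`, `hCB` (`k < K`, `1 ≤ M`, `Provisos₁₃CoPH`). [cite: Balaban1988Convergent, Theorem p.245, (3.24)–(3.25) p.270, (2.18) p.257, (2.20)–(2.25) pp.258–259, (3.16) p.268] -/
theorem clause_succ_CoPH_of_Omega_empty_of_pinChi_of_oldBranch_of_clause (h : θ.Provisos₁₃CoPH F N) {k : ℕ} (hk : k < p.K) (hM : 1 ≤ θ.τ9.M)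
    (s : SeqOfRecord F θ.ν θ.τ9.M (gOfRecord₁₃ F N θ.toStage13Params p) p.K (k + 1)) (hΩ : s.Ω (k + 1) = ∅)
    (hqloc : ∀ j, j < k → ∀ ω ω' : MultiCfg (F.P p.K) (SU N) (FluctV N), (∀ i, i ≤ k → ω i = ω' i) →
      (θ.zhAt p s).quad j (s.init.Λ (j + 1)) ω = (θ.zhAt p s).quad j (s.init.Λ (j + 1)) ω')
    (hpre : ∀ j, j < k → (θ.zhAt p s).ζ0 j = (θ.zhAt p s.init).ζ0 j ∧ (θ.zhAt p s).quad j = (θ.zhAt p s.init).quad j)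
    (t : Sect2.TermValues (F.P p.K) (MatA N) (FluctV N) θ.τ9.M) (E₀ : ℝ)
    (hA : ∀ (S : ℕ → Set (Site (F.P p.K) 0)) (a a' : Tk.MSFluct (F.P p.K) (FluctV N)) (Uf : GaugeField (F.P p.K) 0 (SU N)), (∀ i, i ≤ k → a i = a' i) →
      (sect2ActionDataOfRecord F N (FluctV N) p.K (settingOfRecord₁₃ F N θ.toStage13Params p) (θ.rzAt p s.init) s.init t (S, a) E₀).action23 k Uf =
        (sect2ActionDataOfRecord F N (FluctV N) p.K (settingOfRecord₁₃ F N θ.toStage13Params p) (θ.rzAt p s.init) s.init t (S, a') E₀).action23 k Uf)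
    (hid : slotsOfRecord F N θ.ν θ.τ9 (EOfRecord₁₃ F N θ.toStage13Params) (wOfRecord₉ F N θ.toStage9Params) θ.ppSel p
        (gOfRecord₁₃ F N θ.toStage13Params p) k s.init = 0 ∨
      ∀ᵐ U₀ ∂fieldMeasure (F.P p.K) k (SU N),
        chiSeqOfRecord F N θ.ν θ.τ9.M (gOfRecord₁₃ F N θ.toStage13Params p) p.K k s.init U₀ ≠ 0 →
          slotsOfRecord F N θ.ν θ.τ9 (EOfRecord₁₃ F N θ.toStage13Params) (wOfRecord₉ F N θ.toStage9Params) θ.ppSel p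
              (gOfRecord₁₃ F N θ.toStage13Params p) k s.init U₀ =
            sect2Slot F N (FluctV N) p.K (settingOfRecord₁₃ F N θ.toStage13Params p) (θ.rzAt p s.init) (WtOfRecord₁₃H F N θ p s.init) s.init t E₀
              (UbgOfRecord₁₃CoP F N θ.toStage13Params p k s.init) U₀)
    (hZ : ∀ (V' : GaugeField (F.P p.K) (k + 1) (SU N)) (U₀ : GaugeField (F.P p.K) k (SU N)),
      (θ.zhAt p s).ζ0 k Set.univ (pairCfgAt (V := FluctV N) k V' U₀) =
        chiSeqOfRecord F N θ.ν θ.τ9.M (gOfRecord₁₃ F N θ.toStage13Params p) p.K k s.init U₀ *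
          wOfRecord₉ F N θ.toStage9Params p (gOfRecord₁₃ F N θ.toStage13Params p) k s U₀ ((avOfRecord F N p.K k).avg U₀))
    (hq : ∀ (V' : GaugeField (F.P p.K) (k + 1) (SU N)) (U₀ : GaugeField (F.P p.K) k (SU N)), (θ.zhAt p s).quad k ∅ (pairCfgAt (V := FluctV N) k V' U₀) = 0)
    {C : ℝ}
    (hmB : ∀ S ∈ admSOfRecord F θ.ν θ.τ9.M (gOfRecord₁₃ F N θ.toStage13Params p) p.K k s.init,
      Measurable fun U₀ : GaugeField (F.P p.K) k (SU N) =>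
        tkBranchOfRecord F N (FluctV N) θ.ν θ.τ9.M _ p.K (WtOfRecord₁₃H F N θ p s) s.init S k
          (fun ω => sect2Operand F N (FluctV N) p.K (settingOfRecord₁₃ F N θ.toStage13Params p) (θ.rzAt p s.init) s.init t E₀
            (UbgOfRecord₁₃CoP F N θ.toStage13Params p k s.init) (S, fun j => (ω j).2) (fun j => (ω j).1))
          (baseCfg (V := FluctV N) k U₀))
    (hCB : ∀ S ∈ admSOfRecord F θ.ν θ.τ9.M (gOfRecord₁₃ F N θ.toStage13Params p) p.K k s.init, ∀ U₀ : GaugeField (F.P p.K) k (SU N),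
      |tkBranchOfRecord F N (FluctV N) θ.ν θ.τ9.M _ p.K (WtOfRecord₁₃H F N θ p s) s.init S k
          (fun ω => sect2Operand F N (FluctV N) p.K (settingOfRecord₁₃ F N θ.toStage13Params p) (θ.rzAt p s.init) s.init t E₀
            (UbgOfRecord₁₃CoP F N θ.toStage13Params p k s.init) (S, fun j => (ω j).2) (fun j => (ω j).1))
          (baseCfg (V := FluctV N) k U₀)| ≤ C) :
    slotsTOfRecord F N θ.ν θ.τ9 (EOfRecord₁₃ F N θ.toStage13Params) (wOfRecord₉ F N θ.toStage9Params) θ.ppSel p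
        (gOfRecord₁₃ F N θ.toStage13Params p) (k + 1) s = 0 ∨
      ∀ᵐ V' ∂fieldMeasure (F.P p.K) (k + 1) (SU N),
        chiSeqOfRecord F N θ.ν θ.τ9.M (gOfRecord₁₃ F N θ.toStage13Params p) p.K (k + 1) s V' ≠ 0 →
          slotsTOfRecord F N θ.ν θ.τ9 (EOfRecord₁₃ F N θ.toStage13Params) (wOfRecord₉ F N θ.toStage9Params) θ.ppSel p
              (gOfRecord₁₃ F N θ.toStage13Params p) (k + 1) s V' =
            sect2Slot F N (FluctV N) p.K (settingOfRecord₁₃ F N θ.toStage13Params p) (θ.rzAt p s) (WtOfRecord₁₃H F N θ p s) s t E₀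
              (UbgOfRecord₁₃CoP F N θ.toStage13Params p (k + 1) s) V' := by
  -- abbreviations: the old front factor, the graph step weight, the old branch
  set χk : GaugeField (F.P p.K) k (SU N) → ℝ := chiSeqOfRecord F N θ.ν θ.τ9.M (gOfRecord₁₃ F N θ.toStage13Params p) p.K k s.init with hχk
  set wg : GaugeField (F.P p.K) k (SU N) → ℝ := fun U₀ =>
    wOfRecord₉ F N θ.toStage9Params p (gOfRecord₁₃ F N θ.toStage13Params p) k s U₀ ((avOfRecord F N p.K k).avg U₀) with hwg
  have hχm : Measurable χk := measurable_chiSeqOfRecord_init θ p h hk s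
  have hwm : Measurable wg := by
    have hg : Measurable fun U₀ : GaugeField (F.P p.K) k (SU N) => ((avOfRecord F N p.K k).avg U₀, U₀) :=
      (avOfRecord_measurable F N p.K k).prodMk measurable_id
    simpa only [hwg, Function.comp_def] using ((h.tstep p k hk).measW s).comp hg
  -- the closed form of the new integrand per old branch
  have hnew : ∀ (S : ℕ → Set (Site (F.P p.K) 0)) (V' : GaugeField (F.P p.K) (k + 1) (SU N)) (U₀ : GaugeField (F.P p.K) k (SU N)),
      noExpIntegrandAt F N (FluctV N) p.K k (WtOfRecord₁₃H F N θ p s)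
          (tkBranchOfRecord F N (FluctV N) θ.ν θ.τ9.M _ p.K (WtOfRecord₁₃H F N θ p s) s.init S k
            (fun ω => sect2Operand F N (FluctV N) p.K (settingOfRecord₁₃ F N θ.toStage13Params p) (θ.rzAt p s) s t E₀
              (UbgOfRecord₁₃CoP F N θ.toStage13Params p (k + 1) s) (S, fun j => (ω j).2) (fun j => (ω j).1)))
          V' U₀ =
        χk U₀ * wg U₀ *
          tkBranchOfRecord F N (FluctV N) θ.ν θ.τ9.M _ p.K (WtOfRecord₁₃H F N θ p s) s.init S k
            (fun ω => sect2Operand F N (FluctV N) p.K (settingOfRecord₁₃ F N θ.toStage13Params p) (θ.rzAt p s.init) s.init t E₀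
              (UbgOfRecord₁₃CoP F N θ.toStage13Params p k s.init) (S, fun j => (ω j).2) (fun j => (ω j).1))
            (baseCfg (V := FluctV N) k U₀) := fun S V' U₀ =>
    newIntegrand_eq_of_pinChi θ p hM s hΩ (h.zhLocal p (k + 1) s.Ω s.Λ) hqloc t E₀ S (hA S) hZ hq V' U₀
  refine clause_succ_CoPH_of_Omega_empty_of_pinChi_of_provisos_of_clause θ p h hk hM s hΩ hqloc hpre t E₀ hA hid hZ hq (C := C)
    (fun S hS => ?_) (fun S hS V' U₀ => ?_)
  · -- measurability: the new integrand is a product of three measurable functions of `U₀` alone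
    have heq : Function.uncurry (noExpIntegrandAt F N (FluctV N) p.K k (WtOfRecord₁₃H F N θ p s)
        (tkBranchOfRecord F N (FluctV N) θ.ν θ.τ9.M _ p.K (WtOfRecord₁₃H F N θ p s) s.init S k
          (fun ω => sect2Operand F N (FluctV N) p.K (settingOfRecord₁₃ F N θ.toStage13Params p) (θ.rzAt p s) s t E₀
            (UbgOfRecord₁₃CoP F N θ.toStage13Params p (k + 1) s) (S, fun j => (ω j).2) (fun j => (ω j).1)))) =
        fun z : GaugeField (F.P p.K) (k + 1) (SU N) × GaugeField (F.P p.K) k (SU N) => χk z.2 * wg z.2 *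
          tkBranchOfRecord F N (FluctV N) θ.ν θ.τ9.M _ p.K (WtOfRecord₁₃H F N θ p s) s.init S k
            (fun ω => sect2Operand F N (FluctV N) p.K (settingOfRecord₁₃ F N θ.toStage13Params p) (θ.rzAt p s.init) s.init t E₀
              (UbgOfRecord₁₃CoP F N θ.toStage13Params p k s.init) (S, fun j => (ω j).2) (fun j => (ω j).1))
            (baseCfg (V := FluctV N) k z.2) := by
      funext z
      exact hnew S z.1 z.2
    rw [heq]
    exact ((hχm.comp measurable_snd).mul (hwm.comp measurable_snd)).mul ((hmB S hS).comp measurable_snd)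
  · -- bound: `|χ| ≤ 1`, `|w| ≤ 1`, `|old branch| ≤ C`
    rw [hnew S V' U₀, abs_mul, abs_mul]
    have h1 : |χk U₀| ≤ 1 := abs_chiSeqOfRecord_le_one F N θ.ν θ.τ9.M _ p.K k s.init U₀
    have h2 : |wg U₀| ≤ 1 := (h.tstep p k hk).absW_le s U₀ _
    have h3 := hCB S hS U₀
    calc |χk U₀| * |wg U₀| * |tkBranchOfRecord F N (FluctV N) θ.ν θ.τ9.M _ p.K (WtOfRecord₁₃H F N θ p s) s.init S k
            (fun ω => sect2Operand F N (FluctV N) p.K (settingOfRecord₁₃ F N θ.toStage13Params p) (θ.rzAt p s.init) s.init t E₀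
              (UbgOfRecord₁₃CoP F N θ.toStage13Params p k s.init) (S, fun j => (ω j).2) (fun j => (ω j).1))
            (baseCfg (V := FluctV N) k U₀)|
        ≤ 1 * 1 * C := by
          gcongr
    _ = C := by ring

/-- **… keyed on `SLaw₁₃CoPH θ p k` ITSELF**, old-branch form (`hmB`, `hCB` displayed for every `(t₀, E₀)`): the 𝐓-image clause at `s′` holds for the witness `t (init s′)`
with `E_{k+1}(s′) := E_k(init s′)`. [cite: Balaban1988Convergent, Theorem p.245, Thm 1 p.262, (3.24)–(3.25) p.270] -/
theorem exists_clause_succ_CoPH_of_Omega_empty_of_sLaw₁₃CoPH_of_oldBranch (h : θ.Provisos₁₃CoPH F N) {k : ℕ} (hk : k < p.K) (hM : 1 ≤ θ.τ9.M)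
    (hS : SLaw₁₃CoPH F N θ p k)
    (s : SeqOfRecord F θ.ν θ.τ9.M (gOfRecord₁₃ F N θ.toStage13Params p) p.K (k + 1)) (hΩ : s.Ω (k + 1) = ∅)
    (hqloc : ∀ j, j < k → ∀ ω ω' : MultiCfg (F.P p.K) (SU N) (FluctV N), (∀ i, i ≤ k → ω i = ω' i) →
      (θ.zhAt p s).quad j (s.init.Λ (j + 1)) ω = (θ.zhAt p s).quad j (s.init.Λ (j + 1)) ω')
    (hpre : ∀ j, j < k → (θ.zhAt p s).ζ0 j = (θ.zhAt p s.init).ζ0 j ∧ (θ.zhAt p s).quad j = (θ.zhAt p s.init).quad j)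
    (hA : ∀ (t₀ : Sect2.TermValues (F.P p.K) (MatA N) (FluctV N) θ.τ9.M) (E₀ : ℝ) (S : ℕ → Set (Site (F.P p.K) 0))
      (a a' : Tk.MSFluct (F.P p.K) (FluctV N)) (Uf : GaugeField (F.P p.K) 0 (SU N)), (∀ i, i ≤ k → a i = a' i) →
      (sect2ActionDataOfRecord F N (FluctV N) p.K (settingOfRecord₁₃ F N θ.toStage13Params p) (θ.rzAt p s.init) s.init t₀ (S, a) E₀).action23 k Uf =
        (sect2ActionDataOfRecord F N (FluctV N) p.K (settingOfRecord₁₃ F N θ.toStage13Params p) (θ.rzAt p s.init) s.init t₀ (S, a') E₀).action23 k Uf)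
    (hZ : ∀ (V' : GaugeField (F.P p.K) (k + 1) (SU N)) (U₀ : GaugeField (F.P p.K) k (SU N)),
      (θ.zhAt p s).ζ0 k Set.univ (pairCfgAt (V := FluctV N) k V' U₀) =
        chiSeqOfRecord F N θ.ν θ.τ9.M (gOfRecord₁₃ F N θ.toStage13Params p) p.K k s.init U₀ *
          wOfRecord₉ F N θ.toStage9Params p (gOfRecord₁₃ F N θ.toStage13Params p) k s U₀ ((avOfRecord F N p.K k).avg U₀))
    (hq : ∀ (V' : GaugeField (F.P p.K) (k + 1) (SU N)) (U₀ : GaugeField (F.P p.K) k (SU N)), (θ.zhAt p s).quad k ∅ (pairCfgAt (V := FluctV N) k V' U₀) = 0)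
    {C : ℝ}
    (hmB : ∀ (t₀ : Sect2.TermValues (F.P p.K) (MatA N) (FluctV N) θ.τ9.M) (E₀ : ℝ),
      ∀ S ∈ admSOfRecord F θ.ν θ.τ9.M (gOfRecord₁₃ F N θ.toStage13Params p) p.K k s.init,
      Measurable fun U₀ : GaugeField (F.P p.K) k (SU N) =>
        tkBranchOfRecord F N (FluctV N) θ.ν θ.τ9.M _ p.K (WtOfRecord₁₃H F N θ p s) s.init S k
          (fun ω => sect2Operand F N (FluctV N) p.K (settingOfRecord₁₃ F N θ.toStage13Params p) (θ.rzAt p s.init) s.init t₀ E₀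
            (UbgOfRecord₁₃CoP F N θ.toStage13Params p k s.init) (S, fun j => (ω j).2) (fun j => (ω j).1))
          (baseCfg (V := FluctV N) k U₀))
    (hCB : ∀ (t₀ : Sect2.TermValues (F.P p.K) (MatA N) (FluctV N) θ.τ9.M) (E₀ : ℝ),
      ∀ S ∈ admSOfRecord F θ.ν θ.τ9.M (gOfRecord₁₃ F N θ.toStage13Params p) p.K k s.init, ∀ U₀ : GaugeField (F.P p.K) k (SU N),
      |tkBranchOfRecord F N (FluctV N) θ.ν θ.τ9.M _ p.K (WtOfRecord₁₃H F N θ p s) s.init S k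
          (fun ω => sect2Operand F N (FluctV N) p.K (settingOfRecord₁₃ F N θ.toStage13Params p) (θ.rzAt p s.init) s.init t₀ E₀
            (UbgOfRecord₁₃CoP F N θ.toStage13Params p k s.init) (S, fun j => (ω j).2) (fun j => (ω j).1))
          (baseCfg (V := FluctV N) k U₀)| ≤ C) :
    ∃ (t₀ : Sect2.TermValues (F.P p.K) (MatA N) (FluctV N) θ.τ9.M) (E' : ℝ),
      slotsTOfRecord F N θ.ν θ.τ9 (EOfRecord₁₃ F N θ.toStage13Params) (wOfRecord₉ F N θ.toStage9Params) θ.ppSel p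
          (gOfRecord₁₃ F N θ.toStage13Params p) (k + 1) s = 0 ∨
        ∀ᵐ V' ∂fieldMeasure (F.P p.K) (k + 1) (SU N),
          chiSeqOfRecord F N θ.ν θ.τ9.M (gOfRecord₁₃ F N θ.toStage13Params p) p.K (k + 1) s V' ≠ 0 →
            slotsTOfRecord F N θ.ν θ.τ9 (EOfRecord₁₃ F N θ.toStage13Params) (wOfRecord₉ F N θ.toStage9Params) θ.ppSel p
                (gOfRecord₁₃ F N θ.toStage13Params p) (k + 1) s V' =
              sect2Slot F N (FluctV N) p.K (settingOfRecord₁₃ F N θ.toStage13Params p) (θ.rzAt p s) (WtOfRecord₁₃H F N θ p s) s t₀ E'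
                (UbgOfRecord₁₃CoP F N θ.toStage13Params p (k + 1) s) V' := by
  obtain ⟨t, Ek, -, hs⟩ := (sLaw₁₃CoPH_iff F N θ p k).1 hS
  exact ⟨t s.init, Ek s.init, clause_succ_CoPH_of_Omega_empty_of_pinChi_of_oldBranch_of_clause θ p h hk hM s hΩ hqloc hpre (t s.init) (Ek s.init)
    (hA _ _) (hs s.init).2 hZ hq (hmB _ _) (hCB _ _)⟩

/-- **… AT A LENGTH-FREE RESIDUAL SLOT** (`θ.Zh p n Ω Λ` does not read `n` — e.g. a value built generation-wise from the history): the prefix agreement (P) is AUTOMATIC at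
a no-expansion step (p544575 `prefix_agree_of_levelFree_of_Omega_empty`), so only (V), `hqloc`, `hA`, `hid` and the old-branch `hmB`∕`hCB` remain — the form node00-def-K0a∕K0b's
H3 value meets by its faces. [cite: Balaban1988Convergent, Theorem p.245, (3.24)–(3.25) p.270, p.257] -/
theorem clause_succ_CoPH_of_Omega_empty_of_levelFree_of_pinChi_of_oldBranch_of_clause (h : θ.Provisos₁₃CoPH F N)
    (hZh : ∀ (n n' : ℕ) (Ω Λ : ℕ → Set (Site (F.P p.K) 0)), θ.Zh p n Ω Λ = θ.Zh p n' Ω Λ) {k : ℕ} (hk : k < p.K) (hM : 1 ≤ θ.τ9.M)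
    (s : SeqOfRecord F θ.ν θ.τ9.M (gOfRecord₁₃ F N θ.toStage13Params p) p.K (k + 1)) (hΩ : s.Ω (k + 1) = ∅)
    (hqloc : ∀ j, j < k → ∀ ω ω' : MultiCfg (F.P p.K) (SU N) (FluctV N), (∀ i, i ≤ k → ω i = ω' i) →
      (θ.zhAt p s).quad j (s.init.Λ (j + 1)) ω = (θ.zhAt p s).quad j (s.init.Λ (j + 1)) ω')
    (t : Sect2.TermValues (F.P p.K) (MatA N) (FluctV N) θ.τ9.M) (E₀ : ℝ)
    (hA : ∀ (S : ℕ → Set (Site (F.P p.K) 0)) (a a' : Tk.MSFluct (F.P p.K) (FluctV N)) (Uf : GaugeField (F.P p.K) 0 (SU N)), (∀ i, i ≤ k → a i = a' i) →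
      (sect2ActionDataOfRecord F N (FluctV N) p.K (settingOfRecord₁₃ F N θ.toStage13Params p) (θ.rzAt p s.init) s.init t (S, a) E₀).action23 k Uf =
        (sect2ActionDataOfRecord F N (FluctV N) p.K (settingOfRecord₁₃ F N θ.toStage13Params p) (θ.rzAt p s.init) s.init t (S, a') E₀).action23 k Uf)
    (hid : slotsOfRecord F N θ.ν θ.τ9 (EOfRecord₁₃ F N θ.toStage13Params) (wOfRecord₉ F N θ.toStage9Params) θ.ppSel p
        (gOfRecord₁₃ F N θ.toStage13Params p) k s.init = 0 ∨
      ∀ᵐ U₀ ∂fieldMeasure (F.P p.K) k (SU N),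
        chiSeqOfRecord F N θ.ν θ.τ9.M (gOfRecord₁₃ F N θ.toStage13Params p) p.K k s.init U₀ ≠ 0 →
          slotsOfRecord F N θ.ν θ.τ9 (EOfRecord₁₃ F N θ.toStage13Params) (wOfRecord₉ F N θ.toStage9Params) θ.ppSel p
              (gOfRecord₁₃ F N θ.toStage13Params p) k s.init U₀ =
            sect2Slot F N (FluctV N) p.K (settingOfRecord₁₃ F N θ.toStage13Params p) (θ.rzAt p s.init) (WtOfRecord₁₃H F N θ p s.init) s.init t E₀
              (UbgOfRecord₁₃CoP F N θ.toStage13Params p k s.init) U₀)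
    (hZ : ∀ (V' : GaugeField (F.P p.K) (k + 1) (SU N)) (U₀ : GaugeField (F.P p.K) k (SU N)),
      (θ.zhAt p s).ζ0 k Set.univ (pairCfgAt (V := FluctV N) k V' U₀) =
        chiSeqOfRecord F N θ.ν θ.τ9.M (gOfRecord₁₃ F N θ.toStage13Params p) p.K k s.init U₀ *
          wOfRecord₉ F N θ.toStage9Params p (gOfRecord₁₃ F N θ.toStage13Params p) k s U₀ ((avOfRecord F N p.K k).avg U₀))
    (hq : ∀ (V' : GaugeField (F.P p.K) (k + 1) (SU N)) (U₀ : GaugeField (F.P p.K) k (SU N)), (θ.zhAt p s).quad k ∅ (pairCfgAt (V := FluctV N) k V' U₀) = 0)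
    {C : ℝ}
    (hmB : ∀ S ∈ admSOfRecord F θ.ν θ.τ9.M (gOfRecord₁₃ F N θ.toStage13Params p) p.K k s.init,
      Measurable fun U₀ : GaugeField (F.P p.K) k (SU N) =>
        tkBranchOfRecord F N (FluctV N) θ.ν θ.τ9.M _ p.K (WtOfRecord₁₃H F N θ p s) s.init S k
          (fun ω => sect2Operand F N (FluctV N) p.K (settingOfRecord₁₃ F N θ.toStage13Params p) (θ.rzAt p s.init) s.init t E₀
            (UbgOfRecord₁₃CoP F N θ.toStage13Params p k s.init) (S, fun j => (ω j).2) (fun j => (ω j).1))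
          (baseCfg (V := FluctV N) k U₀))
    (hCB : ∀ S ∈ admSOfRecord F θ.ν θ.τ9.M (gOfRecord₁₃ F N θ.toStage13Params p) p.K k s.init, ∀ U₀ : GaugeField (F.P p.K) k (SU N),
      |tkBranchOfRecord F N (FluctV N) θ.ν θ.τ9.M _ p.K (WtOfRecord₁₃H F N θ p s) s.init S k
          (fun ω => sect2Operand F N (FluctV N) p.K (settingOfRecord₁₃ F N θ.toStage13Params p) (θ.rzAt p s.init) s.init t E₀
            (UbgOfRecord₁₃CoP F N θ.toStage13Params p k s.init) (S, fun j => (ω j).2) (fun j => (ω j).1))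
          (baseCfg (V := FluctV N) k U₀)| ≤ C) :
    slotsTOfRecord F N θ.ν θ.τ9 (EOfRecord₁₃ F N θ.toStage13Params) (wOfRecord₉ F N θ.toStage9Params) θ.ppSel p
        (gOfRecord₁₃ F N θ.toStage13Params p) (k + 1) s = 0 ∨
      ∀ᵐ V' ∂fieldMeasure (F.P p.K) (k + 1) (SU N),
        chiSeqOfRecord F N θ.ν θ.τ9.M (gOfRecord₁₃ F N θ.toStage13Params p) p.K (k + 1) s V' ≠ 0 →
          slotsTOfRecord F N θ.ν θ.τ9 (EOfRecord₁₃ F N θ.toStage13Params) (wOfRecord₉ F N θ.toStage9Params) θ.ppSel p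
              (gOfRecord₁₃ F N θ.toStage13Params p) (k + 1) s V' =
            sect2Slot F N (FluctV N) p.K (settingOfRecord₁₃ F N θ.toStage13Params p) (θ.rzAt p s) (WtOfRecord₁₃H F N θ p s) s t E₀
              (UbgOfRecord₁₃CoP F N θ.toStage13Params p (k + 1) s) V' :=
  clause_succ_CoPH_of_Omega_empty_of_pinChi_of_oldBranch_of_clause θ p h hk hM s hΩ hqloc (prefix_agree_of_levelFree_of_Omega_empty θ p hZh s hΩ) t E₀ hA
    hid hZ hq hmB hCB

end OldBranch

end Summit.QuantumFields.YangMills.Theorems.BalabanUVNodesN11NoExpansionGeneralStepCoPHOldBranch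

end
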